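import Literature.Claims.NS.Kosovtsov2022
import Literature.Analysis.FluidPDE.NSLerayHopfSereginEnergyProofs
import Literature.Analysis.FluidPDE.WholeSpaceIBP
import Literature.Analysis.FluidPDE.PressurePoisson
import Literature.Analysis.PDE.NewtonianPotentialRegularity
import HarnessLib

/-!
# C33 `Kosovtsov2022` — the test field and its Leray pressure (part 1 of 2)

Support file for `SoloRefuteKosovtsov2022NS.lean`, which refutes the typed steps
`Literature.Claims.NS.Kosovtsov2022.Step_3` (§3 p.7 l.9–11: "the generator of the Navier–Stokes
equations is bounded … in the space `L²_u`") and hence `Step_2` (§2 p.4 l.1–2), and shows the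
generation hypotheses of Proposition 1 (p.8) fail for the Navier–Stokes operator at every `ν`.

This file constructs, inside the skeleton's own interface (`AdmDF`, `IsLerayPressure`):
* the poloidal test field `u = curl curl (χ e₂)`, `χ = φ · q`, `φ` a bump `≡ 1` on the unit
  ball, `q = x₀x₂²/2 + x₁³/6`; `u` is smooth, compactly supported (hence rapidly decreasing,
  `HasRapidSpatialDecay.of_hasCompactSupport`) and divergence free (Schwarz);
* its pressure `p = N ∗ (−tr (∇u)²)` by the tree's Newtonian potential theory
  (`Literature.Analysis.PDE.Newtonian.*`): smooth, `Δp = −Σ ∂ᵢuⱼ∂ⱼuᵢ`, bounded, `→ 0` at `∞`.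

All statements are proved ([folklore]); no facts. WHAT THIS IS NOT: not a claim about NS
regularity or blow-up; not a claim about any author beyond the typed locator.
-/

set_option linter.dupNamespace false

open MeasureTheory Set Filter Metric Module
open scoped ContDiff Topology Laplacian InnerProductSpace

namespace Summit.NavierStokesRegularity.NavierStokesRegularity.Theorems.Kosovtsov2022

open Literature.Claims.NS.Kosovtsov2022 Literature.Analysis.FluidPDE

noncomputable section

/-! ## A. Coordinates and partial derivatives on `ℝ³` -/

/-- The coordinate vector `e_k` (= the skeleton's `basisVec k`). [folklore] -/
abbrev e (k : Fin 3) : Euc 3 := EuclideanSpace.single k 1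

/-- Components of `e_k`. [folklore] -/
@[simp] theorem e_apply (k j : Fin 3) : (e k) j = if j = k then 1 else 0 := by
  simp [e]

/-- The partial derivative `∂_k f` of a scalar function. [folklore] -/
def D (k : Fin 3) (f : Euc 3 → ℝ) : Euc 3 → ℝ := fun x => fderiv ℝ f x (e k)

/-- `∂_k` preserves smoothness. [folklore] -/
theorem contDiff_D {f : Euc 3 → ℝ} (hf : ContDiff ℝ ∞ f) (k : Fin 3) : ContDiff ℝ ∞ (D k f) :=
  (contDiff_infty_iff_fderiv.1 hf).2.clm_apply contDiff_const

/-- Schwarz: `∂_i ∂_j f = ∂_j ∂_i f` for smooth `f`. [folklore] -/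
theorem D_comm {f : Euc 3 → ℝ} (hf : ContDiff ℝ ∞ f) (i j : Fin 3) : D i (D j f) = D j (D i f) := by
  funext x
  have hd : Differentiable ℝ (fderiv ℝ f) :=
    (contDiff_infty_iff_fderiv.1 hf).2.differentiable (by simp)
  have hs : IsSymmSndFDerivAt ℝ f x :=
    hf.contDiffAt.isSymmSndFDerivAt (by simp; exact WithTop.coe_le_coe.2 le_top)
  show fderiv ℝ (fun y => fderiv ℝ f y (e j)) x (e i) =
    fderiv ℝ (fun y => fderiv ℝ f y (e i)) x (e j)
  rw [fderiv_apply_const_apply (hd x), fderiv_apply_const_apply (hd x)]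
  exact hs _ _

/-- Locality of `∂_k`: functions agreeing on an open set have equal partials there. [folklore] -/
theorem D_congr {f g : Euc 3 → ℝ} {U : Set (Euc 3)} (hU : IsOpen U) (h : EqOn f g U) (k : Fin 3) :
    EqOn (D k f) (D k g) U := fun x hx => by
  simp only [D]
  rw [(h.eventuallyEq_of_mem (hU.mem_nhds hx)).fderiv_eq]

/-- The partial derivative of a coordinate function. [folklore] -/
theorem D_coord (k i : Fin 3) : D k (fun x : Euc 3 => x i) = fun _ => if i = k then 1 else 0 := by
  funext x
  simp only [D]
  rw [show (fun x : Euc 3 => x i) = EuclideanSpace.proj (𝕜 := ℝ) i from rfl,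
    (EuclideanSpace.proj (𝕜 := ℝ) i).fderiv]
  simp

/-- `∂_k` of a constant. [folklore] -/
theorem D_const (k : Fin 3) (c : ℝ) : D k (fun _ : Euc 3 => c) = fun _ => 0 := by
  funext x; simp [D]

/-- Vanishing outside the closed ball of radius `2` (carries compact support through the
construction). [folklore] -/
def Van {F : Type*} [Zero F] (f : Euc 3 → F) : Prop := ∀ x : Euc 3, 2 < ‖x‖ → f x = 0

/-- The exterior region is open. [folklore] -/
theorem isOpen_ext : IsOpen {x : Euc 3 | 2 < ‖x‖} := isOpen_lt continuous_const continuous_norm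

/-- A derivative of a function vanishing outside the ball vanishes there. [folklore] -/
theorem Van.fderiv_apply {F : Type*} [NormedAddCommGroup F] [NormedSpace ℝ F] {f : Euc 3 → F}
    (h : Van f) (v : Euc 3) : Van (fun x => fderiv ℝ f x v) := fun x hx => by
  have hev : f =ᶠ[𝓝 x] fun _ => (0 : F) :=
    (show EqOn f (fun _ => (0 : F)) {y | 2 < ‖y‖} from fun y hy => h y hy).eventuallyEq_of_mem
      (isOpen_ext.mem_nhds hx)
  show fderiv ℝ f x v = 0
  rw [hev.fderiv_eq]; simp

/-- `Van` for `∂_k`. [folklore] -/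
theorem Van.D {f : Euc 3 → ℝ} (h : Van f) (k : Fin 3) : Van (D k f) := h.fderiv_apply (e k)

/-- `Van` gives compact support. [folklore] -/
theorem Van.hasCompactSupport {F : Type*} [Zero F] [TopologicalSpace F] {f : Euc 3 → F}
    (h : Van f) : HasCompactSupport f :=
  HasCompactSupport.intro (isCompact_closedBall (0 : Euc 3) 2) fun x hx =>
    h x (by simpa [mem_closedBall_zero_iff, not_le] using hx)

/-- `Van` functions have topological support in the open ball of radius `3`. [folklore] -/
theorem Van.tsupport_subset {f : Euc 3 → ℝ} (h : Van f) : tsupport f ⊆ ball (0 : Euc 3) 3 := by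
  refine (closure_minimal (fun x hx => ?_) isClosed_closedBall).trans
    (closedBall_subset_ball (by norm_num : (2:ℝ) < 3))
  rw [mem_closedBall_zero_iff]
  by_contra hlt
  exact hx (h x (not_le.1 hlt))

/-! ## B. The poloidal test field `u` -/

/-- A smooth bump: `1` on the closed unit ball, supported in the ball of radius `2`. [folklore] -/
def bump3 : ContDiffBump (0 : Euc 3) := ⟨1, 2, one_pos, one_lt_two⟩

/-- The cut-off `φ`. [folklore] -/
def cut (x : Euc 3) : ℝ := (bump3 : Euc 3 → ℝ) x

/-- The cubic `q(x) = x₀x₂²/2 + x₁³/6`. [folklore] -/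
def q (x : Euc 3) : ℝ := 2⁻¹ * (x 0 * x 2 ^ 2) + 6⁻¹ * x 1 ^ 3

/-- The potential `χ = φ·q`. [folklore] -/
def χ (x : Euc 3) : ℝ := cut x * q x

/-- `ψ = ∂₂ χ`. [folklore] -/
def ψ : Euc 3 → ℝ := D 2 χ

/-- The components `(∂₀ψ, ∂₁ψ, −(∂₀∂₀χ + ∂₁∂₁χ))` of the poloidal field `curl curl (χ e₂)`.
[folklore] -/
def comps : Fin 3 → Euc 3 → ℝ :=
  ![D 0 ψ, D 1 ψ, fun x => -(D 0 (D 0 χ) x + D 1 (D 1 χ) x)]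

/-- The test field `u = Σ_j u_j e_j`. [folklore] -/
def uK (x : Euc 3) : Euc 3 := ∑ j, comps j x • e j

/-- Components of `u`. [folklore] -/
@[simp] theorem uK_apply (x : Euc 3) (j : Fin 3) : uK x j = comps j x := by
  simp [uK, Fin.sum_univ_three]
  fin_cases j <;> simp

/-- `q` is smooth. [folklore] -/
theorem q_contDiff : ContDiff ℝ ∞ q := by
  have hc : ∀ i : Fin 3, ContDiff ℝ ∞ (fun x : Euc 3 => x i) := fun i =>
    contDiff_euclidean.1 contDiff_id i
  unfold q
  exact (contDiff_const.mul ((hc 0).mul ((hc 2).pow 2))).add (contDiff_const.mul ((hc 1).pow 3))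

/-- `φ` is smooth. [folklore] -/
theorem cut_contDiff : ContDiff ℝ ∞ cut := bump3.contDiff

/-- `χ` is smooth. [folklore] -/
theorem χ_contDiff : ContDiff ℝ ∞ χ := cut_contDiff.mul q_contDiff

/-- `ψ` is smooth. [folklore] -/
theorem ψ_contDiff : ContDiff ℝ ∞ ψ := contDiff_D χ_contDiff 2

/-- The components are smooth. [folklore] -/
theorem comps_contDiff (j : Fin 3) : ContDiff ℝ ∞ (comps j) := by
  fin_cases j
  · exact contDiff_D ψ_contDiff 0
  · exact contDiff_D ψ_contDiff 1
  · exact ((contDiff_D (contDiff_D χ_contDiff 0) 0).add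
      (contDiff_D (contDiff_D χ_contDiff 1) 1)).neg

/-- `u` is smooth. [folklore] -/
theorem uK_contDiff : ContDiff ℝ ∞ uK :=
  ContDiff.sum fun j _ => (comps_contDiff j).smul contDiff_const

/-- `φ` vanishes outside the ball of radius `2`. [folklore] -/
theorem cut_van : Van cut := fun x hx =>
  bump3.zero_of_le_dist (by simpa [bump3, dist_zero_right] using hx.le)

/-- `χ` vanishes outside the ball. [folklore] -/
theorem χ_van : Van χ := fun x hx => by simp [χ, cut_van x hx]

/-- The components vanish outside the ball. [folklore] -/
theorem comps_van (j : Fin 3) : Van (comps j) := by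
  fin_cases j
  · exact (χ_van.D 2).D 0
  · exact (χ_van.D 2).D 1
  · intro x hx
    simp [comps, (χ_van.D 0).D 0 x hx, (χ_van.D 1).D 1 x hx]

/-- `u` vanishes outside the ball. [folklore] -/
theorem uK_van : Van uK := fun x hx => by
  simp [uK, comps_van _ x hx]

/-- `u` has compact support. [folklore] -/
theorem uK_hasCompactSupport : HasCompactSupport uK := uK_van.hasCompactSupport

/-- The derivative of `u`: `Du(x) v = Σ_j (Du_j(x) v) e_j`. [folklore] -/
theorem fderiv_uK (x v : Euc 3) : fderiv ℝ uK x v = ∑ j, (fderiv ℝ (comps j) x v) • e j := by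
  have h : HasFDerivAt uK (∑ j, (fderiv ℝ (comps j) x).smulRight (e j)) x := by
    unfold uK
    exact HasFDerivAt.fun_sum fun j _ =>
      (((comps_contDiff j).differentiable (by simp)) x).hasFDerivAt.smul_const (e j)
  rw [h.fderiv]
  simp [ContinuousLinearMap.smulRight_apply]

/-- Entries of `∇u`: `(Du(x) e_i)_j = ∂_i u_j (x)` (= the skeleton's `pd i j u x`). [folklore] -/
theorem pd_uK (i j : Fin 3) (x : Euc 3) : pd i j uK x = D i (comps j) x := by
  simp only [pd, basisVec]
  rw [show (EuclideanSpace.single i (1:ℝ) : Euc 3) = e i from rfl, fderiv_uK]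
  simp [Fin.sum_univ_three, D]
  fin_cases j <;> simp

/-- `u` is divergence free: `div u = ∂₀∂₀∂₂χ + ∂₁∂₁∂₂χ − ∂₂(∂₀∂₀χ + ∂₁∂₁χ) = 0` by Schwarz.
[folklore] -/
theorem uK_divFree : NSWave0.IsDivFree uK := by
  intro x
  change VectorCalculus.divergence uK x = 0
  rw [divergence_eq_sum_inner_fderiv (EuclideanSpace.basisFun (Fin 3) ℝ)]
  have hb : ∀ i : Fin 3, (EuclideanSpace.basisFun (Fin 3) ℝ) i = e i := fun i => by
    simp [e]
  simp only [hb]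
  have hin : ∀ i : Fin 3, ⟪e i, fderiv ℝ uK x (e i)⟫_ℝ = D i (comps i) x := fun i => by
    rw [show ⟪e i, fderiv ℝ uK x (e i)⟫_ℝ = (fderiv ℝ uK x (e i)) i by
      simp [e, EuclideanSpace.inner_single_left]]
    rw [fderiv_uK]; simp [Fin.sum_univ_three, D]; fin_cases i <;> simp
  simp only [hin, Fin.sum_univ_three]
  -- the three diagonal terms
  have h0 : D 0 (comps 0) = D 2 (D 0 (D 0 χ)) := by
    show D 0 (D 0 (D 2 χ)) = D 2 (D 0 (D 0 χ))
    rw [D_comm χ_contDiff 0 2]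
    exact D_comm (contDiff_D χ_contDiff 0) 0 2
  have h1 : D 1 (comps 1) = D 2 (D 1 (D 1 χ)) := by
    show D 1 (D 1 (D 2 χ)) = D 2 (D 1 (D 1 χ))
    rw [D_comm χ_contDiff 1 2]
    exact D_comm (contDiff_D χ_contDiff 1) 1 2
  have h2 : D 2 (comps 2) x = -(D 2 (D 0 (D 0 χ)) x + D 2 (D 1 (D 1 χ)) x) := by
    show fderiv ℝ (fun y => -(D 0 (D 0 χ) y + D 1 (D 1 χ) y)) x (e 2) = _
    have ha := ((contDiff_D (contDiff_D χ_contDiff 0) 0).differentiable (by simp)) x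
    have hb' := ((contDiff_D (contDiff_D χ_contDiff 1) 1).differentiable (by simp)) x
    rw [fderiv_fun_neg, fderiv_fun_add ha hb']
    simp [D]
  rw [h0, h1, h2]; ring

/-- `u` is an admissible divergence-free field (smooth, rapidly decreasing, `div u = 0`).
[folklore] -/
theorem admDF_uK : AdmDF uK :=
  ⟨⟨uK_contDiff, HasRapidSpatialDecay.of_hasCompactSupport uK_contDiff uK_hasCompactSupport⟩,
    uK_divFree⟩

/-! ## C. The pressure `p = N ∗ (−tr (∇u)²)` -/

/-- `Q = Σ_{ij} ∂_i u_j ∂_j u_i = tr((∇u)²)`, the skeleton's Poisson datum. [folklore] -/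
def Q (x : Euc 3) : ℝ := ∑ i, ∑ j, pd i j uK x * pd j i uK x

/-- `Q` in terms of the components. [folklore] -/
theorem Q_eq : Q = fun x => ∑ i, ∑ j, D i (comps j) x * D j (comps i) x := by
  funext x; simp [Q, pd_uK]

/-- `−Q`. [folklore] -/
def negQ (x : Euc 3) : ℝ := -Q x

/-- `−Q` is smooth. [folklore] -/
theorem negQ_contDiff : ContDiff ℝ ∞ negQ := by
  have hQ : ContDiff ℝ ∞ Q := by
    rw [Q_eq]
    exact ContDiff.sum fun i _ => ContDiff.sum fun j _ =>
      (contDiff_D (comps_contDiff j) i).mul (contDiff_D (comps_contDiff i) j)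
  exact hQ.neg

/-- `−Q` vanishes outside the ball of radius `2`. [folklore] -/
theorem negQ_van : Van negQ := fun x hx => by
  simp [negQ, Q_eq, (comps_van _).D _ x hx]

/-- `−Q` is integrable. [folklore] -/
theorem negQ_integrable : Integrable negQ :=
  negQ_contDiff.continuous.integrable_of_hasCompactSupport negQ_van.hasCompactSupport

/-- `dim ℝ³ = 3 ≥ 3`. [folklore] -/
theorem three_le_finrank : 3 ≤ Module.finrank ℝ (Euc 3) :=
  (finrank_euclideanSpace_fin (𝕜 := ℝ) (n := 3)).ge

/-- The pressure: the Newtonian potential of `−Q` (tree: `Literature.Analysis.PDE.Newtonian`).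
[folklore] -/
def pK : Euc 3 → ℝ := Literature.Analysis.PDE.Newtonian.potential 0 negQ

/-- `p` is smooth. [folklore] -/
theorem pK_contDiff : ContDiff ℝ ∞ pK :=
  contDiff_infty.2 fun _ => Literature.Analysis.PDE.Newtonian.contDiff_potential_of_contDiff
    three_le_finrank le_rfl (negQ_contDiff.of_le (by exact_mod_cast le_top))
    negQ_van.tsupport_subset

/-- `Δp = −Q`. [folklore] -/
theorem laplacian_pK (x : Euc 3) : Δ pK x = -Q x :=
  Literature.Analysis.PDE.Newtonian.laplacian_potential_eq_self three_le_finrank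
    (negQ_contDiff.of_le (WithTop.coe_le_coe.2 le_top)) negQ_van.tsupport_subset x

/-- `p` is bounded. [folklore] -/
theorem pK_bounded : ∃ C : ℝ, ∀ x, |pK x| ≤ C := by
  obtain ⟨M, hM⟩ := Literature.Analysis.PDE.Newtonian.exists_abs_le_of_hasCompactSupport
    negQ_contDiff.continuous negQ_van.hasCompactSupport
  exact ⟨_, fun x => Literature.Analysis.PDE.Newtonian.abs_potential_le three_le_finrank le_rfl
    negQ_integrable hM (Literature.Analysis.PDE.Newtonian.eq_zero_of_tsupport_subset
      negQ_van.tsupport_subset) (by norm_num) x⟩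

/-- `p(x) = O(1/|x|)`: `p → 0` at infinity. [folklore] -/
theorem pK_tendsto : Tendsto pK (cocompact (Euc 3)) (𝓝 0) := by
  have hA : 0 < Literature.Analysis.PDE.Newtonian.bumpMass (Euc 3) :=
    Literature.Analysis.PDE.Newtonian.bumpMass_pos three_le_finrank
  set A : ℝ := Literature.Analysis.PDE.Newtonian.bumpMass (Euc 3) with hAdef
  set K : ℝ := (∫ z, |negQ z|) * (2 * A⁻¹)
  have hbound : ∀ x : Euc 3, 4 ≤ ‖x‖ → ‖pK x‖ ≤ K * ‖x‖⁻¹ := by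
    intro x hx
    have hxpos : 0 < ‖x‖ := by linarith
    have hker : ∀ z, ‖negQ z * Literature.Analysis.PDE.Newtonian.kernel 0 (x - z)‖ ≤
        |negQ z| * (2 * A⁻¹ * ‖x‖⁻¹) := by
      intro z
      by_cases hz : negQ z = 0
      · simp [hz]
      · have hz2 : ‖z‖ ≤ 2 := not_lt.1 fun h => hz (negQ_van z h)
        have hxz : ‖x‖ / 2 ≤ ‖x - z‖ := by
          have := norm_sub_norm_le x z
          linarith
        have hxz0 : 0 < ‖x - z‖ := by linarith
        rw [norm_mul, Real.norm_eq_abs, Real.norm_eq_abs]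
        gcongr
        rw [Literature.Analysis.PDE.Newtonian.abs_kernel_zero_eq three_le_finrank,
          Literature.Analysis.PDE.Newtonian.two_mul_expo, finrank_euclideanSpace_fin]
        rw [show (-(((3 : ℕ) : ℝ) - 2)) = (-1 : ℝ) by norm_num, Real.rpow_neg_one]
        calc A⁻¹ * ‖x - z‖⁻¹ ≤ A⁻¹ * (‖x‖ / 2)⁻¹ := by gcongr
          _ = 2 * A⁻¹ * ‖x‖⁻¹ := by field_simp
    calc ‖pK x‖ = ‖∫ z, negQ z * Literature.Analysis.PDE.Newtonian.kernel 0 (x - z)‖ := rfl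
      _ ≤ ∫ z, |negQ z| * (2 * A⁻¹ * ‖x‖⁻¹) :=
          norm_integral_le_of_norm_le (negQ_integrable.abs.mul_const _)
            (Eventually.of_forall hker)
      _ = K * ‖x‖⁻¹ := by rw [integral_mul_const]; ring
  have hlim : Tendsto (fun x : Euc 3 => K * ‖x‖⁻¹) (cocompact (Euc 3)) (𝓝 0) := by
    simpa using (tendsto_inv_atTop_zero.comp tendsto_norm_cocompact_atTop).const_mul K
  exact squeeze_zero_norm'
    ((tendsto_norm_cocompact_atTop.eventually (eventually_ge_atTop (4 : ℝ))).mono hbound) hlim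

/-- `p` is a Leray pressure for `u` in the skeleton's sense. [folklore] -/
theorem isLerayPressure_pK : IsLerayPressure uK pK :=
  ⟨pK_contDiff, fun x => by rw [laplacian_pK]; rfl, pK_bounded, pK_tendsto⟩

end

end Summit.NavierStokesRegularity.NavierStokesRegularity.Theorems.Kosovtsov2022
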